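import Summits.CriticalPhenomena.SAWScalingLimit.Theses.SAWPoissonSubstrate
import Summits.CriticalPhenomena.SAWScalingLimit.Theorems.SAWLoopFugacityFlowAvoidanceDeterminesLaw

/-!
# Line `birth` — registered skeleton (BC3) for the crux `SAWPoissonSubstrate.SubstrateUniversality`

Crux item stmt-CriticalPhenomena-6937 (rank 2 of `route-CriticalPhenomena-SAWPoissonSubstrate`,
sub-problem `CriticalPhenomena/SAWScalingLimit`). Skeleton registrar
`planner-skel-stmt-CriticalPhenomena-6937-0`, 2026-08-17 (birth certificate BC3; route re-audit bin
REPAIRABLE). Namespace `Summit.CriticalPhenomena.SAWScalingLimit.Cruxes.SubstrateUniversality.Birth`.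

## The crux (FIXED; concluded BY NAME by `SubstrateUniversality_of`)

(U) For every Poisson functor `Pois` (a Poisson point process for every locally finite atomless
intensity on `ℂ`), every Dobrushin domain `(D; a, b)` and every `δℤ²` endpoint approximation
`(a_δ, b_δ)` (`SAW.IsEndpointApprox`), and every bounded continuous `f : CurveClass ℂ → ℝ`,
`∫ f∘curve dP^{ℤ²}_{D,δ} − ∫ f dQ_{D,δ} → 0` along `δ → 0⁺`, where `P^{ℤ²}_{D,δ} = SAW.law D.carrier δ a_δ b_δ`
is the critical square-lattice SAW law and `Q_{D,δ} = Q 1 D δ` the ANNEALED critical SAW law of the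
Poisson honeycomb (Voronoi-vertex graph of `Pois (δ⁻² dA)`, fugacity `1/μ_PV`, walk between the
domain vertices nearest to `a`, `b`) — the inline `let` chain of the item, kept verbatim below.

## The line: HULL-AVOIDANCE MATCHING OF JOINT SUBSEQUENTIAL LIMITS
(the route header's foreseen two-layer plan "SubstrateUniversality ⇐ UTight → UAvoidance", made
kernel-checkable now that the π-system uniqueness `AvoidanceDeterminesLaw` (stmt-CriticalPhenomena-1373)
is a THEOREM of the tree: `Theorems/SAWLoopFugacityFlowAvoidanceDeterminesLaw.lean`,
`AvoidanceDeterminesLaw_proof`)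

Along the countably generated filter `𝓝[>] 0` a real function tends to `0` iff every mesh sequence
`δₙ → 0⁺` has a subsequence along which it does (`Filter.tendsto_of_subseq_tendsto`). The crux is cut
into the two A-PRIORI packages of the two families (different substrates, different literatures) and
ONE identification statement about LIMIT OBJECTS, in the coordinates in which a law on simple chords
is determined — its hull-avoidance probabilities:

* `stub_latticePackage` (ℤ² a-priori package; open, XL): along every mesh sequence the pushed-forward
  critical `δℤ²` SAW laws of `(D; a_δ, b_δ)` have a subsequence converging weakly (bounded continuous
  test functions) to a PROBABILITY law carried by the simple chords of `D` from `a` to `b` meeting `∂D`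
  only at `a, b`. = eventual tightness (shared item `EventualTight`, stmt-CriticalPhenomena-1372 — the
  repaired EVENTUAL form, never the refuted all-δ stmt-0772) + honesty (mass → 1) + simplicity and
  boundary avoidance of subsequential limits (`SAWExcursionCardy.SimpleSubseqLimits` /
  `SAWBrownianDomination.SubseqSimple`) + Prokhorov; sources KemppainenSmirnov2017 Thm 1.5,
  AizenmanBurchard1999, DuminilCopinHammond2013. Says NOTHING about the Poisson side.
* `stub_substratePackage` (Poisson-honeycomb a-priori package; open, XL): the same for the annealed
  laws `Q 1 D (tₙ)`, for every Poisson functor. = the sibling route's `SAWPoissonHoneycomb.PVTightSimple`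
  (stmt-CriticalPhenomena-6939: mass → 1, eventual tightness, simple subsequential limits) + the closed
  support clause `range ⊆ closure D` + Prokhorov. Says NOTHING about `δℤ²`.
* `stub_avoidanceMatching` (THE HEART; open-problem): whenever, along ONE mesh sequence `sₙ → 0⁺`, the
  `δℤ²` laws converge weakly to a chordal probability law `P` and the annealed Poisson-honeycomb laws to
  a chordal probability law `P'`, the two limits give the SAME mass to `{range ⊆ closure D'}` for every
  hull subdomain `D'` of `D` (same marked points, agreeing with `D` near them — the admissibility clause
  of `AvoidanceDeterminesLaw`, verbatim). This is substrate universality in LSW's coordinates: by the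
  EXACT finite-volume restriction identities on both substrates (`law_D(· | walk stays in D'_δ) = law_{D'}`
  on `δℤ²`; the quenched identity on induced Voronoi subgraphs, LawlerSchrammWerner2004SAW §3.4.5, on the
  Poisson side) the two masses are limits of RATIOS OF CRITICAL PARTITION FUNCTIONS
  `Z_δ(D'; a, b) / Z_δ(D; a, b)` (resp. their annealed Poisson–Voronoi analogues), so the stub asserts that
  these dimensionless ratios have substrate-independent limits — numbers, testable by enumeration /
  flatPERM on sampled environments (the route's CHEAPEST FALSIFIER, sharpened), and the natural target of
  a coupling or Kennedy–Lawler boundary-layer argument; the VALUES (`Φ'_A(0)^{5/8}`, which would identify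
  SLE_{8/3} through `SAWChargeContinuation.RestrictionIdentification`) are NOT asserted — only their
  equality across substrates. Sources: LawlerSchrammWerner2003Restriction §3, LawlerSchrammWerner2004SAW
  §3.4.5 and Prediction 1, KennedyLawler2013, BenjaminiSchramm1998.

COMPOSITION (`SubstrateUniversality_of`, kernel-checked, no `sorry` of its own): subsequence criterion
along `𝓝[>] 0`; extract a `δℤ²`-convergent subsequence (stub 1), inside it a Poisson-convergent one
(stub 2); the two chordal probability limits `P, P'` have equal hull-avoidance masses (stub 3), hence
`P = P'` by the LANDED `AvoidanceDeterminesLaw_proof`; so along that subsequence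
`∫ f∘curve dP^{ℤ²} − ∫ f dQ → ∫ f dP − ∫ f dP' = 0` (`Filter.Tendsto.sub`, `sub_self`).

Why no stub is a costume / the cut is not a shred: stubs 1 and 2 each speak of ONE family only and are
NOT consequences of the crux (two non-tight families may well have asymptotically equal test integrals);
stub 3 speaks of limit objects only, is silent without the packages, and replaces "all bounded
continuous test functions" by the countable geometric family of hull-avoidance numbers — it is implied
by the crux only modulo the packages and the uniqueness of weak limits, and gives the crux back only
through stubs 1–2 AND the π-system theorem. BC3 probes (registrar folder `bc/SubstrateUniversality_probe.lean`):
for each stub `T`, `example : T → SubstrateUniversality` and `example : T → SAWScalingLimit` by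
`first | exact? | simpa [T] | (unfold T; simpa) | aesop` FAIL (6/6; audit quoted in `Lines/birth.md`).

Disproof used: none exists (`ledger crux ls stmt-CriticalPhenomena-6937`: no workfiles before this one;
no `Theorems/SubstrateUniversality/Negative/`). Negatives index (`ledger negatives --problem
CriticalPhenomena`, 11 entries, 2026-08-17): only stmt-CriticalPhenomena-0772 (ALL-δ tightness
`IsTightMeasureSet` of the `δℤ²` laws, refuted by `SAWParafermionTight_refuted`) is nearby — not met:
every statement here is sequential along `tₙ → 0⁺` (the eventual form), and no tightness of any fixed-δ
law is asserted. Barriers (route header): `EmbeddingModulusUniqueness` bites stub 3 exactly as it bites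
the crux (the `δℤ²` side keeps its square embedding `SAW.law`; nothing is claimed modulo linear maps);
`SupercriticalSAWSpaceFilling` is respected (both families at their own critical fugacities; a
supercritical `1/μ_PV` for confined walks would falsify stub 2, i.e. the sibling's PVTightSimple, not
fake the matching).
-/

noncomputable section

namespace Summit.CriticalPhenomena.SAWScalingLimit.Cruxes.SubstrateUniversality.Birth

open scoped Topology
open Filter

/-! ### The stub statements (named `Prop`s; the Poisson–Voronoi `let` chain is the item's, verbatim) -/

/-- **Statement of stub 1 — the `δℤ²` a-priori package.** For every Dobrushin domain, every endpoint
approximation and every mesh sequence `tₙ → 0⁺` there are a subsequence `φ` and a probability law `P`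
on `CurveClass ℂ`, carried by the simple chords of `D` from `D.pt 0` to `D.pt 1` inside `closure D`
meeting `frontier D` only at the marked points, such that `∫ f∘curve dP^{ℤ²}_{D, t (φ n)} → ∫ f dP` for
every bounded continuous `f`. (Eventual tightness stmt-CriticalPhenomena-1372 + honesty + simple
subsequential limits + Prokhorov.)
[cite: KemppainenSmirnov2017, Theorem 1.5] [cite: LawlerSchrammWerner2004SAW, §3.4.2] -/
def LatticePackage : Prop :=
  ∀ (D : Literature.Probability.RandomPlanarGeometry.DobrushinDomain) (a b : ℝ → Literature.Probability.LatticeModels.Site 2), Literature.Probability.RandomPlanarGeometry.SAW.IsEndpointApprox D a b → ∀ t : ℕ → ℝ, Filter.Tendsto t Filter.atTop (nhdsWithin 0 (Set.Ioi 0)) → ∃ φ : ℕ → ℕ, StrictMono φ ∧ ∃ P : MeasureTheory.Measure (Literature.Probability.RandomPlanarGeometry.CurveClass ℂ), MeasureTheory.IsProbabilityMeasure P ∧ (∀ᵐ γ ∂P, γ ∈ Literature.Probability.RandomPlanarGeometry.CurveClass.simple ∧ γ.source = D.pt 0 ∧ γ.target = D.pt 1 ∧ γ.range ⊆ closure D.carrier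 ∧ γ.range ∩ frontier D.carrier ⊆ {D.pt 0, D.pt 1}) ∧ ∀ f : BoundedContinuousFunction (Literature.Probability.RandomPlanarGeometry.CurveClass ℂ) ℝ, Filter.Tendsto (fun n => ∫ γ, f γ.curve ∂(Literature.Probability.RandomPlanarGeometry.SAW.law D.carrier (t (φ n)) (a (t (φ n))) (b (t (φ n))))) Filter.atTop (nhds (∫ x, f x ∂P))

/-- **Statement of stub 2 — the Poisson-honeycomb a-priori package.** For every Poisson functor, every
Dobrushin domain and every mesh sequence `tₙ → 0⁺` there are a subsequence `φ` and a probability law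
`P` on `CurveClass ℂ`, carried by the simple chords of `D` (same clause), such that the ANNEALED critical
Poisson-honeycomb laws `Q 1 D (t (φ n))` converge weakly to `P`. (The sibling's PVTightSimple,
stmt-CriticalPhenomena-6939, + the closed support clause + Prokhorov.)
[cite: LawlerSchrammWerner2004SAW, §3.4.5] [cite: BenjaminiSchramm1998] -/
def SubstratePackage : Prop :=
  ∀ (Pois : MeasureTheory.Measure ℂ → MeasureTheory.Measure (Literature.Analysis.FunctionSpaces.PointConfig ℂ)), (∀ ν : MeasureTheory.Measure ℂ, MeasureTheory.IsLocallyFiniteMeasure ν → (∀ z : ℂ, ν {z} = 0) → Literature.Analysis.FunctionSpaces.IsPoissonPointProcess ν (Pois ν)) → let S : Literature.Analysis.FunctionSpaces.PointConfig ℂ → ℂ → Set ℂ := fun ω c => (ω : Set ℂ) ∩ Metric.sphere c (Metric.infDist c (ω : Set ℂ)); let vor : Literature.Analysis.FunctionSpaces.PointConfig ℂ → SimpleGraph ℂ := fun ω => SimpleGraph.fromRel fun c c' => 3 ≤ (S ω c).encard ∧ 3 ≤ (S ω c').encard ∧ (S ω c ∩ S ω c').encard = 2; let μ : ENNReal :=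 essSup (fun ω => Filter.limsup (fun n : ℕ => (⨆ c : Metric.closedBall (0 : ℂ) 1, (Literature.Probability.RandomPlanarGeometry.SAW.sawCount (vor ω) (c : ℂ) n : ENNReal)) ^ (1 / (n : ℝ))) Filter.atTop) (Pois MeasureTheory.volume); let xc : ℝ := (μ.toReal)⁻¹; let near : Literature.Analysis.FunctionSpaces.PointConfig ℂ → Set ℂ → ℂ → ℂ := fun ω Ω z => Classical.epsilon fun v : ℂ => v ∈ Literature.Probability.RandomPlanarGeometry.SAW.embMeshDomain (vor ω) id Ω 1 ∧ ∀ w ∈ Literature.Probability.RandomPlanarGeometry.SAW.embMeshDomain (vor ω) id Ω 1, dist v z ≤ dist w z; let intens : (ℂ → ℝ) → ℝ → MeasureTheory.Measure ℂ := fun ρ δ => ENNReal.ofReal (δ⁻¹ ^ 2) • MeasureTheory.volume.withDensity fun z => ENNReal.ofReal (ρ z); let qlaw : Literature.Probability.RandomPlanarGeometry.DobrushinDomain → Literature.Analysis.FunctionSpaces.PointConfig ℂ → MeasureTheory.Measure (Literature.Probability.RandomPlanarGeometry.CurveClass ℂ) := fun D ω => (Literature.Probability.RandomPlanarGeometry.SAW.embLaw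 (vor ω) id D.carrier 1 xc (near ω D.carrier (D.pt 0)) (near ω D.carrier (D.pt 1))).map fun γ => γ.curve; let Q : (ℂ → ℝ) → Literature.Probability.RandomPlanarGeometry.DobrushinDomain → ℝ → MeasureTheory.Measure (Literature.Probability.RandomPlanarGeometry.CurveClass ℂ) := fun ρ D δ => (Pois (intens ρ δ)).bind (qlaw D); ∀ (D : Literature.Probability.RandomPlanarGeometry.DobrushinDomain) (t : ℕ → ℝ), Filter.Tendsto t Filter.atTop (nhdsWithin 0 (Set.Ioi 0)) → ∃ φ : ℕ → ℕ, StrictMono φ ∧ ∃ P : MeasureTheory.Measure (Literature.Probability.RandomPlanarGeometry.CurveClass ℂ), MeasureTheory.IsProbabilityMeasure P ∧ (∀ᵐ γ ∂P, γ ∈ Literature.Probability.RandomPlanarGeometry.CurveClass.simple ∧ γ.source = D.pt 0 ∧ γ.target = D.pt 1 ∧ γ.range ⊆ closure D.carrier ∧ γ.range ∩ frontier D.carrier ⊆ {D.pt 0, D.pt 1}) ∧ ∀ f : BoundedContinuousFunction (Literature.Probability.RandomPlanarGeometry.CurveClass ℂ) ℝ, Filter.Tendsto (fun n => ∫ x,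 f x ∂(Q (fun _ => 1) D (t (φ n)))) Filter.atTop (nhds (∫ x, f x ∂P))

/-- **Statement of stub 3 — hull-avoidance matching of joint subsequential limits (the heart).** For
every Poisson functor, Dobrushin domain `(D; a, b)`, endpoint approximation and mesh sequence
`sₙ → 0⁺`: if the `δℤ²` critical SAW laws converge weakly along `sₙ` to a chordal probability law `P`
and the annealed critical Poisson-honeycomb laws to a chordal probability law `P'`, then
`P {range ⊆ closure D'} = P' {range ⊆ closure D'}` for every Dobrushin `D' ⊆ D` with the same marked
points agreeing with `D` near them (the admissibility clause of `AvoidanceDeterminesLaw`, verbatim).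
Substrate-independence of the limiting ratios of critical partition functions in nested domains;
the values are not asserted.
[cite: LawlerSchrammWerner2003Restriction, §3] [cite: LawlerSchrammWerner2004SAW, §3.4.5 and Prediction 1]
[cite: KennedyLawler2013] -/
def AvoidanceMatching : Prop :=
  ∀ (Pois : MeasureTheory.Measure ℂ → MeasureTheory.Measure (Literature.Analysis.FunctionSpaces.PointConfig ℂ)), (∀ ν : MeasureTheory.Measure ℂ, MeasureTheory.IsLocallyFiniteMeasure ν → (∀ z : ℂ, ν {z} = 0) → Literature.Analysis.FunctionSpaces.IsPoissonPointProcess ν (Pois ν)) → let S : Literature.Analysis.FunctionSpaces.PointConfig ℂ → ℂ → Set ℂ := fun ω c => (ω : Set ℂ) ∩ Metric.sphere c (Metric.infDist c (ω : Set ℂ)); let vor : Literature.Analysis.FunctionSpaces.PointConfig ℂ → SimpleGraph ℂ := fun ω => SimpleGraph.fromRel fun c c' => 3 ≤ (S ω c).encard ∧ 3 ≤ (S ω c').encard ∧ (S ω c ∩ S ω c').encard = 2; let μ : ENNReal := essSup (fun ω => Filter.limsup (fun n : ℕ => (⨆ c : Metric.closedBall (0 : ℂ) 1, (Literature.Probability.RandomPlanarGeometry.SAW.sawCount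 (vor ω) (c : ℂ) n : ENNReal)) ^ (1 / (n : ℝ))) Filter.atTop) (Pois MeasureTheory.volume); let xc : ℝ := (μ.toReal)⁻¹; let near : Literature.Analysis.FunctionSpaces.PointConfig ℂ → Set ℂ → ℂ → ℂ := fun ω Ω z => Classical.epsilon fun v : ℂ => v ∈ Literature.Probability.RandomPlanarGeometry.SAW.embMeshDomain (vor ω) id Ω 1 ∧ ∀ w ∈ Literature.Probability.RandomPlanarGeometry.SAW.embMeshDomain (vor ω) id Ω 1, dist v z ≤ dist w z; let intens : (ℂ → ℝ) → ℝ → MeasureTheory.Measure ℂ := fun ρ δ => ENNReal.ofReal (δ⁻¹ ^ 2) • MeasureTheory.volume.withDensity fun z => ENNReal.ofReal (ρ z); let qlaw : Literature.Probability.RandomPlanarGeometry.DobrushinDomain → Literature.Analysis.FunctionSpaces.PointConfig ℂ → MeasureTheory.Measure (Literature.Probability.RandomPlanarGeometry.CurveClass ℂ) := fun D ω => (Literature.Probability.RandomPlanarGeometry.SAW.embLaw (vor ω) id D.carrier 1 xc (near ω D.carrier (D.pt 0)) (near ω D.carrier (D.pt 1))).map fun γ => γ.curve; let Q : (ℂ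 → ℝ) → Literature.Probability.RandomPlanarGeometry.DobrushinDomain → ℝ → MeasureTheory.Measure (Literature.Probability.RandomPlanarGeometry.CurveClass ℂ) := fun ρ D δ => (Pois (intens ρ δ)).bind (qlaw D); ∀ (D : Literature.Probability.RandomPlanarGeometry.DobrushinDomain) (a b : ℝ → Literature.Probability.LatticeModels.Site 2), Literature.Probability.RandomPlanarGeometry.SAW.IsEndpointApprox D a b → ∀ s : ℕ → ℝ, Filter.Tendsto s Filter.atTop (nhdsWithin 0 (Set.Ioi 0)) → ∀ P P' : MeasureTheory.Measure (Literature.Probability.RandomPlanarGeometry.CurveClass ℂ), MeasureTheory.IsProbabilityMeasure P → MeasureTheory.IsProbabilityMeasure P' → (∀ᵐ γ ∂P, γ ∈ Literature.Probability.RandomPlanarGeometry.CurveClass.simple ∧ γ.source = D.pt 0 ∧ γ.target = D.pt 1 ∧ γ.range ⊆ closure D.carrier ∧ γ.range ∩ frontier D.carrier ⊆ {D.pt 0, D.pt 1}) → (∀ᵐ γ ∂P', γ ∈ Literature.Probability.RandomPlanarGeometry.CurveClass.simple ∧ γ.source = D.pt 0 ∧ γ.target = D.pt 1 ∧ γ.range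 ⊆ closure D.carrier ∧ γ.range ∩ frontier D.carrier ⊆ {D.pt 0, D.pt 1}) → (∀ f : BoundedContinuousFunction (Literature.Probability.RandomPlanarGeometry.CurveClass ℂ) ℝ, Filter.Tendsto (fun n => ∫ γ, f γ.curve ∂(Literature.Probability.RandomPlanarGeometry.SAW.law D.carrier (s n) (a (s n)) (b (s n)))) Filter.atTop (nhds (∫ x, f x ∂P))) → (∀ f : BoundedContinuousFunction (Literature.Probability.RandomPlanarGeometry.CurveClass ℂ) ℝ, Filter.Tendsto (fun n => ∫ x, f x ∂(Q (fun _ => 1) D (s n))) Filter.atTop (nhds (∫ x, f x ∂P'))) → ∀ D' : Literature.Probability.RandomPlanarGeometry.DobrushinDomain, D'.carrier ⊆ D.carrier → D'.pt 0 = D.pt 0 → D'.pt 1 = D.pt 1 → (∃ ε : ℝ, 0 < ε ∧ D'.carrier ∩ Metric.ball (D.pt 0) ε = D.carrier ∩ Metric.ball (D.pt 0) ε ∧ D'.carrier ∩ Metric.ball (D.pt 1) ε = D.carrier ∩ Metric.ball (D.pt 1) ε) → P (Literature.Probability.RandomPlanarGeometry.CurveClass.rangeSubset (closure D'.carrier))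 = P' (Literature.Probability.RandomPlanarGeometry.CurveClass.rangeSubset (closure D'.carrier))

/-! ### The stubs (the ONLY `sorry`s of this file; signatures = the statements above, written out) -/

/-- **Stub 1 = `LatticePackage`, verbatim** (`δℤ²` a-priori package: sequential weak precompactness
with chordal probability limits). Open, XL. -/
theorem stub_latticePackage :
    ∀ (D : Literature.Probability.RandomPlanarGeometry.DobrushinDomain) (a b : ℝ → Literature.Probability.LatticeModels.Site 2), Literature.Probability.RandomPlanarGeometry.SAW.IsEndpointApprox D a b → ∀ t : ℕ → ℝ, Filter.Tendsto t Filter.atTop (nhdsWithin 0 (Set.Ioi 0)) → ∃ φ : ℕ → ℕ, StrictMono φ ∧ ∃ P : MeasureTheory.Measure (Literature.Probability.RandomPlanarGeometry.CurveClass ℂ), MeasureTheory.IsProbabilityMeasure P ∧ (∀ᵐ γ ∂P, γ ∈ Literature.Probability.RandomPlanarGeometry.CurveClass.simple ∧ γ.source = D.pt 0 ∧ γ.target = D.pt 1 ∧ γ.range ⊆ closure D.carrier ∧ γ.range ∩ frontier D.carrier ⊆ {D.pt 0, D.pt 1}) ∧ ∀ f : BoundedContinuousFunction (Literature.Probability.RandomPlanarGeometry.CurveClass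 ℂ) ℝ, Filter.Tendsto (fun n => ∫ γ, f γ.curve ∂(Literature.Probability.RandomPlanarGeometry.SAW.law D.carrier (t (φ n)) (a (t (φ n))) (b (t (φ n))))) Filter.atTop (nhds (∫ x, f x ∂P)) := by
  sorry

/-- **Stub 2 = `SubstratePackage`, verbatim** (Poisson-honeycomb a-priori package). Open, XL. -/
theorem stub_substratePackage :
    ∀ (Pois : MeasureTheory.Measure ℂ → MeasureTheory.Measure (Literature.Analysis.FunctionSpaces.PointConfig ℂ)), (∀ ν : MeasureTheory.Measure ℂ, MeasureTheory.IsLocallyFiniteMeasure ν → (∀ z : ℂ, ν {z} = 0) → Literature.Analysis.FunctionSpaces.IsPoissonPointProcess ν (Pois ν)) → let S : Literature.Analysis.FunctionSpaces.PointConfig ℂ → ℂ → Set ℂ := fun ω c => (ω : Set ℂ) ∩ Metric.sphere c (Metric.infDist c (ω : Set ℂ)); let vor : Literature.Analysis.FunctionSpaces.PointConfig ℂ → SimpleGraph ℂ := fun ω => SimpleGraph.fromRel fun c c' => 3 ≤ (S ω c).encard ∧ 3 ≤ (S ω c').encard ∧ (S ω c ∩ S ω c').encard = 2; let μ : ENNReal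 := essSup (fun ω => Filter.limsup (fun n : ℕ => (⨆ c : Metric.closedBall (0 : ℂ) 1, (Literature.Probability.RandomPlanarGeometry.SAW.sawCount (vor ω) (c : ℂ) n : ENNReal)) ^ (1 / (n : ℝ))) Filter.atTop) (Pois MeasureTheory.volume); let xc : ℝ := (μ.toReal)⁻¹; let near : Literature.Analysis.FunctionSpaces.PointConfig ℂ → Set ℂ → ℂ → ℂ := fun ω Ω z => Classical.epsilon fun v : ℂ => v ∈ Literature.Probability.RandomPlanarGeometry.SAW.embMeshDomain (vor ω) id Ω 1 ∧ ∀ w ∈ Literature.Probability.RandomPlanarGeometry.SAW.embMeshDomain (vor ω) id Ω 1, dist v z ≤ dist w z; let intens : (ℂ → ℝ) → ℝ → MeasureTheory.Measure ℂ := fun ρ δ => ENNReal.ofReal (δ⁻¹ ^ 2) • MeasureTheory.volume.withDensity fun z => ENNReal.ofReal (ρ z); let qlaw : Literature.Probability.RandomPlanarGeometry.DobrushinDomain → Literature.Analysis.FunctionSpaces.PointConfig ℂ → MeasureTheory.Measure (Literature.Probability.RandomPlanarGeometry.CurveClass ℂ) := fun D ω => (Literature.Probability.RandomPlanarGeometry.SAW.embLaw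 (vor ω) id D.carrier 1 xc (near ω D.carrier (D.pt 0)) (near ω D.carrier (D.pt 1))).map fun γ => γ.curve; let Q : (ℂ → ℝ) → Literature.Probability.RandomPlanarGeometry.DobrushinDomain → ℝ → MeasureTheory.Measure (Literature.Probability.RandomPlanarGeometry.CurveClass ℂ) := fun ρ D δ => (Pois (intens ρ δ)).bind (qlaw D); ∀ (D : Literature.Probability.RandomPlanarGeometry.DobrushinDomain) (t : ℕ → ℝ), Filter.Tendsto t Filter.atTop (nhdsWithin 0 (Set.Ioi 0)) → ∃ φ : ℕ → ℕ, StrictMono φ ∧ ∃ P : MeasureTheory.Measure (Literature.Probability.RandomPlanarGeometry.CurveClass ℂ), MeasureTheory.IsProbabilityMeasure P ∧ (∀ᵐ γ ∂P, γ ∈ Literature.Probability.RandomPlanarGeometry.CurveClass.simple ∧ γ.source = D.pt 0 ∧ γ.target = D.pt 1 ∧ γ.range ⊆ closure D.carrier ∧ γ.range ∩ frontier D.carrier ⊆ {D.pt 0, D.pt 1}) ∧ ∀ f : BoundedContinuousFunction (Literature.Probability.RandomPlanarGeometry.CurveClass ℂ) ℝ, Filter.Tendsto (fun n => ∫ x,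 f x ∂(Q (fun _ => 1) D (t (φ n)))) Filter.atTop (nhds (∫ x, f x ∂P)) := by
  sorry

/-- **Stub 3 = `AvoidanceMatching`, verbatim** (hull-avoidance matching of joint subsequential
limits; the load-bearing stub). Open-problem. -/
theorem stub_avoidanceMatching :
    ∀ (Pois : MeasureTheory.Measure ℂ → MeasureTheory.Measure (Literature.Analysis.FunctionSpaces.PointConfig ℂ)), (∀ ν : MeasureTheory.Measure ℂ, MeasureTheory.IsLocallyFiniteMeasure ν → (∀ z : ℂ, ν {z} = 0) → Literature.Analysis.FunctionSpaces.IsPoissonPointProcess ν (Pois ν)) → let S : Literature.Analysis.FunctionSpaces.PointConfig ℂ → ℂ → Set ℂ := fun ω c => (ω : Set ℂ) ∩ Metric.sphere c (Metric.infDist c (ω : Set ℂ)); let vor : Literature.Analysis.FunctionSpaces.PointConfig ℂ → SimpleGraph ℂ := fun ω => SimpleGraph.fromRel fun c c' => 3 ≤ (S ω c).encard ∧ 3 ≤ (S ω c').encard ∧ (S ω c ∩ S ω c').encard = 2; let μ : ENNReal := essSup (fun ω => Filter.limsup (fun n : ℕ => (⨆ c : Metric.closedBall (0 : ℂ) 1,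 (Literature.Probability.RandomPlanarGeometry.SAW.sawCount (vor ω) (c : ℂ) n : ENNReal)) ^ (1 / (n : ℝ))) Filter.atTop) (Pois MeasureTheory.volume); let xc : ℝ := (μ.toReal)⁻¹; let near : Literature.Analysis.FunctionSpaces.PointConfig ℂ → Set ℂ → ℂ → ℂ := fun ω Ω z => Classical.epsilon fun v : ℂ => v ∈ Literature.Probability.RandomPlanarGeometry.SAW.embMeshDomain (vor ω) id Ω 1 ∧ ∀ w ∈ Literature.Probability.RandomPlanarGeometry.SAW.embMeshDomain (vor ω) id Ω 1, dist v z ≤ dist w z; let intens : (ℂ → ℝ) → ℝ → MeasureTheory.Measure ℂ := fun ρ δ => ENNReal.ofReal (δ⁻¹ ^ 2) • MeasureTheory.volume.withDensity fun z => ENNReal.ofReal (ρ z); let qlaw : Literature.Probability.RandomPlanarGeometry.DobrushinDomain → Literature.Analysis.FunctionSpaces.PointConfig ℂ → MeasureTheory.Measure (Literature.Probability.RandomPlanarGeometry.CurveClass ℂ) := fun D ω => (Literature.Probability.RandomPlanarGeometry.SAW.embLaw (vor ω) id D.carrier 1 xc (near ω D.carrier (D.pt 0)) (near ω D.carrier (D.pt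 1))).map fun γ => γ.curve; let Q : (ℂ → ℝ) → Literature.Probability.RandomPlanarGeometry.DobrushinDomain → ℝ → MeasureTheory.Measure (Literature.Probability.RandomPlanarGeometry.CurveClass ℂ) := fun ρ D δ => (Pois (intens ρ δ)).bind (qlaw D); ∀ (D : Literature.Probability.RandomPlanarGeometry.DobrushinDomain) (a b : ℝ → Literature.Probability.LatticeModels.Site 2), Literature.Probability.RandomPlanarGeometry.SAW.IsEndpointApprox D a b → ∀ s : ℕ → ℝ, Filter.Tendsto s Filter.atTop (nhdsWithin 0 (Set.Ioi 0)) → ∀ P P' : MeasureTheory.Measure (Literature.Probability.RandomPlanarGeometry.CurveClass ℂ), MeasureTheory.IsProbabilityMeasure P → MeasureTheory.IsProbabilityMeasure P' → (∀ᵐ γ ∂P, γ ∈ Literature.Probability.RandomPlanarGeometry.CurveClass.simple ∧ γ.source = D.pt 0 ∧ γ.target = D.pt 1 ∧ γ.range ⊆ closure D.carrier ∧ γ.range ∩ frontier D.carrier ⊆ {D.pt 0, D.pt 1}) → (∀ᵐ γ ∂P', γ ∈ Literature.Probability.RandomPlanarGeometry.CurveClass.simple ∧ γ.source = D.pt 0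 ∧ γ.target = D.pt 1 ∧ γ.range ⊆ closure D.carrier ∧ γ.range ∩ frontier D.carrier ⊆ {D.pt 0, D.pt 1}) → (∀ f : BoundedContinuousFunction (Literature.Probability.RandomPlanarGeometry.CurveClass ℂ) ℝ, Filter.Tendsto (fun n => ∫ γ, f γ.curve ∂(Literature.Probability.RandomPlanarGeometry.SAW.law D.carrier (s n) (a (s n)) (b (s n)))) Filter.atTop (nhds (∫ x, f x ∂P))) → (∀ f : BoundedContinuousFunction (Literature.Probability.RandomPlanarGeometry.CurveClass ℂ) ℝ, Filter.Tendsto (fun n => ∫ x, f x ∂(Q (fun _ => 1) D (s n))) Filter.atTop (nhds (∫ x, f x ∂P'))) → ∀ D' : Literature.Probability.RandomPlanarGeometry.DobrushinDomain, D'.carrier ⊆ D.carrier → D'.pt 0 = D.pt 0 → D'.pt 1 = D.pt 1 → (∃ ε : ℝ, 0 < ε ∧ D'.carrier ∩ Metric.ball (D.pt 0) ε = D.carrier ∩ Metric.ball (D.pt 0) ε ∧ D'.carrier ∩ Metric.ball (D.pt 1) ε = D.carrier ∩ Metric.ball (D.pt 1) ε) → P (Literature.Probability.RandomPlanarGeometry.CurveClass.rangeSubset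 (closure D'.carrier)) = P' (Literature.Probability.RandomPlanarGeometry.CurveClass.rangeSubset (closure D'.carrier)) := by
  sorry

/-! ### Registered names of the stub statements (reducible aliases, for the skeleton audit) -/
namespace Registered

/-- `LatticePackage`, under the name of its stub. -/
abbrev stub_latticePackage : Prop := LatticePackage
/-- `SubstratePackage`, under the name of its stub. -/
abbrev stub_substratePackage : Prop := SubstratePackage
/-- `AvoidanceMatching`, under the name of its stub. -/
abbrev stub_avoidanceMatching : Prop := AvoidanceMatching

end Registered

/-! ### The composition (sorry-free) -/

/-- **`SubstrateUniversality` from the line `birth`** (kernel-checked, no `sorry` of its own).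
Subsequence criterion along `𝓝[>] 0`; nested extraction of a `δℤ²`-convergent and then a
Poisson-convergent subsequence (stubs 1, 2); equal hull-avoidance masses of the two chordal probability
limits (stub 3); `P = P'` by the landed π-system uniqueness `AvoidanceDeterminesLaw_proof`
(stmt-CriticalPhenomena-1373); difference of the two limits is `0`. Hypotheses = the three stubs under
their registered names; conclusion = the route decl BY NAME. -/
theorem SubstrateUniversality_of (h1 : Registered.stub_latticePackage)
    (h2 : Registered.stub_substratePackage) (h3 : Registered.stub_avoidanceMatching) :
    Summit.CriticalPhenomena.SAWScalingLimit.Theses.SAWPoissonSubstrate.SubstrateUniversality := by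
  intro Pois hPois
  have h1' : LatticePackage := h1
  have h2' := (show SubstratePackage from h2) Pois hPois
  have h3' := (show AvoidanceMatching from h3) Pois hPois
  clear h1 h2 h3
  intro S vor μ xc near intens qlaw Q D a b hab f
  refine Filter.tendsto_of_subseq_tendsto fun ns hns => ?_
  -- stub 1: a δℤ²-convergent subsequence with a chordal probability limit `P`
  obtain ⟨φ₁, hφ₁, P, hP, hcarP, hlimP⟩ := h1' D a b hab ns hns
  have hns₁ : Filter.Tendsto (fun n => ns (φ₁ n)) Filter.atTop (nhdsWithin 0 (Set.Ioi 0)) :=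
    hns.comp hφ₁.tendsto_atTop
  -- stub 2: inside it, a Poisson-convergent subsequence with a chordal probability limit `P'`
  obtain ⟨φ₂, hφ₂, P', hP', hcarP', hlimP'⟩ := h2' D (fun n => ns (φ₁ n)) hns₁
  have hns₂ : Filter.Tendsto (fun n => ns (φ₁ (φ₂ n))) Filter.atTop (nhdsWithin 0 (Set.Ioi 0)) :=
    hns₁.comp hφ₂.tendsto_atTop
  have hlimP₂ : ∀ g : BoundedContinuousFunction (Literature.Probability.RandomPlanarGeometry.CurveClass ℂ) ℝ,
      Filter.Tendsto (fun n => ∫ γ, g γ.curve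
        ∂(Literature.Probability.RandomPlanarGeometry.SAW.law D.carrier (ns (φ₁ (φ₂ n)))
            (a (ns (φ₁ (φ₂ n)))) (b (ns (φ₁ (φ₂ n)))))) Filter.atTop (nhds (∫ x, g x ∂P)) :=
    fun g => (hlimP g).comp hφ₂.tendsto_atTop
  -- stub 3: the two limits have the same hull-avoidance masses …
  have havoid := h3' D a b hab (fun n => ns (φ₁ (φ₂ n))) hns₂ P P' hP hP' hcarP hcarP' hlimP₂
    (fun g => hlimP' g)
  -- … hence coincide, by the landed π-system uniqueness (stmt-CriticalPhenomena-1373)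
  have hPP' : P = P' :=
    Summit.CriticalPhenomena.SAWScalingLimit.Theorems.AvoidanceDeterminesLaw.AvoidanceDeterminesLaw_proof
      D P P' hP hP' hcarP hcarP' havoid
  refine ⟨fun n => φ₁ (φ₂ n), ?_⟩
  have h12 := (hlimP₂ f).sub (hlimP' f)
  rw [hPP', sub_self] at h12
  exact h12

/-- Wiring check: the registered stubs feed the composition as stated (this term becomes the crux
proof when the three `sorry`s above are discharged). -/
theorem SubstrateUniversality_proof :
    Summit.CriticalPhenomena.SAWScalingLimit.Theses.SAWPoissonSubstrate.SubstrateUniversality :=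
  SubstrateUniversality_of stub_latticePackage stub_substratePackage stub_avoidanceMatching

end Summit.CriticalPhenomena.SAWScalingLimit.Cruxes.SubstrateUniversality.Birth

end
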